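import Literature.Geometry.Riemannian.RiemannianDistance
import Literature.Geometry.Lorentzian.LeviCivita
import Literature.Geometry.Lorentzian.EnergyCurrents
import Literature.Geometry.Lorentzian.Volume
import HarnessLib

/-!
# Scalar curvature sign, growth of the potential and volume growth of complete gradient
# shrinking Ricci solitons (Haslhofer–Müller 2011, §2; Cao–Zhou 2010; Zhang 2009) — named fact

For a complete connected gradient shrinking Ricci soliton `(Mⁿ, g, f)`, `Ric + Hess f = g/2`, with
Haslhofer–Müller's auxiliary constant `C₁(g) = R + |∇f|² - f` ((2.5); `= 0` in the normalisation
`R + |∇f|² = f` used by the tree's shrinker statements), R. Haslhofer, R. Müller, *A compactness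
theorem for complete Ricci shrinkers*, GAFA 21 (2011) = arXiv:1005.3255, §2 (p. 5) print:

* (2.6): "Gradient shrinkers always have nonnegative scalar curvature, `R ≥ 0`. This follows from
  the elliptic equation `R + ⟨∇f,∇R⟩ = ΔR + 2|Rc|²` by the maximum principle, see [Zha09] for a
  proof in the noncompact case without curvature assumptions."
* Lemma 2.1 (Growth of the potential): "Let `(Mⁿ,g,f)` be a gradient shrinker with `C₁ = C₁(g)`
  as in (2.5). Then there exists a point `p ∈ M` where `f` attains its infimum and `f` satisfies
  the quadratic growth estimate `¼(d(x,p) - 5n)₊² ≤ f(x) + C₁ ≤ ¼(d(x,p) + √(2n))²` for all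
  `x ∈ M`, where `a₊ := max{0,a}`."
* Lemma 2.2 (Volume growth): "There exists a constant `C₂ = C₂(n) < ∞` such that every gradient
  shrinker `(Mⁿ,g,f)` with `p ∈ M` as in Lemma 2.1 satisfies the volume growth estimate
  `Vol B_r(p) ≤ C₂ rⁿ`." (All `r > 0`: proof in App., p. 15, small radii by Bakry–Émery volume
  comparison.)

Standing assumptions (§1): complete, connected. The original statements, with constants
depending on the soliton, are H.-D. Cao, D. Zhou, *On complete gradient shrinking Ricci
solitons*, JDG 85 (2010), Thms. 1.1–1.2 [CaoZhou2009]. The fact `shrinkerPotentialGrowth` renders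
(2.6) and the two lemmas for the normalisation `C₁ = 0`, with radii `r : ℝ≥0` compared to the
extended Riemannian distance `g.edist` (so that no finiteness of the distance is presupposed) and
`Vol` the Riemannian measure `riemannianMeasure` of the open `g.edist`-ball. First users: the
analytic steps (second moments, integrability of polynomials in `f` against `e^{-f} dV`, HM §2
"any polynomial in `R, f, |∇f|, Δf` is integrable with respect to the measure `e^{-f}dV`") of stub
`stub_collapsedDirectionReduction` of crux `EntropyRung.NoncompactShrinkerGap`
(Summits/SmoothPoincare4). What is NOT here: the proofs (second variation along minimising
geodesics; the ODE for `r⁻ⁿ V(r)`), and Lemma 2.3 (non-collapsing).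

## References

* [HaslhoferMuller2011] R. Haslhofer, R. Müller, GAFA 21 (2011), 1091–1116 = arXiv:1005.3255:
  §2, (2.3)–(2.6), Lemmas 2.1–2.2 (p. 5); App. (p. 15). READ.
* [CaoZhou2009] H.-D. Cao, D. Zhou, J. Differential Geom. 85 (2010), 175–186: Thms. 1.1–1.2.
-/

noncomputable section

open scoped Manifold ContDiff Topology ENNReal NNReal
open Set

namespace Literature.Geometry.Riemannian

open Lorentzian

/-- **Haslhofer–Müller 2011, §2: (2.6), Lemma 2.1, Lemma 2.2** for a complete connected gradient
shrinker normalised by `R + |∇f|² = f` (`C₁ = 0`), any dimension `n`: there is `C₂ = C₂(n)` such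
that for every such `(M, g, f)` (closed `g`-balls compact, Levi-Civita connection, `f` smooth,
`Ric + Hess f = g/2`, `R + |∇f|² = f`): (a) `R ≥ 0` everywhere; (b) there is a minimum point `p`
of `f` with `¼(d(x,p) - 5n)₊² ≤ f(x) ≤ ¼(d(x,p) + √(2n))²` — rendered: for `r : ℝ≥0`,
`r ≤ d(p,x) ⇒ ¼(r - 5n)₊² ≤ f(x)` and `d(p,x) ≤ r ⇒ f(x) ≤ ¼(r + √(2n))²` (monotone in `r`, so
equivalent to the printed two-sided bound whenever `d(p,x) < ∞`); (c) `Vol B_r(p) ≤ C₂ rⁿ` for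
every `r` (open `g.edist`-ball, Riemannian measure). Named fact (D-0014).
[cite: HaslhoferMuller2011, §2: (2.6), Lemma 2.1, Lemma 2.2 (p. 5)] [cite: CaoZhou2009, Thms. 1.1–1.2] -/
def shrinkerPotentialGrowth : Prop :=
  ∀ n : ℕ, ∃ C₂ : ℝ, ∀ (M : Type) [TopologicalSpace M] [T2Space M] [SecondCountableTopology M]
    [ChartedSpace (EuclideanSpace ℝ (Fin n)) M] [IsManifold (𝓡 n) ∞ M] [ConnectedSpace M]
    [T3Space M] [MeasurableSpace M] [BorelSpace M]
    (g : PseudoRiemannianMetric (𝓡 n) ∞ (EuclideanSpace ℝ (Fin n)) (TangentSpace (𝓡 n) : M → Type _))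
    [g.HasLeviCivita] (f : M → ℝ) (hg : g.IsRiemannian),
    (∀ (x : M) (r : NNReal), IsCompact {y : M | g.edist hg x y ≤ r}) →
    ContMDiff (𝓡 n) 𝓘(ℝ, ℝ) ∞ f →
    (∀ (x : M) (X Y : TangentSpace (𝓡 n) x),
      g.ricci x X Y + g.hessian f x X Y = (1 / 2 : ℝ) * g.val x X Y) →
    (∀ x : M, g.scalarCurvature x + g.gradSq f x = f x) →
    (∀ x : M, 0 ≤ g.scalarCurvature x) ∧
    ∃ p : M, (∀ x : M, f p ≤ f x) ∧
      (∀ (x : M) (r : NNReal), (r : ℝ≥0∞) ≤ g.edist hg p x →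
        (1 / 4 : ℝ) * (max ((r : ℝ) - 5 * n) 0) ^ 2 ≤ f x) ∧
      (∀ (x : M) (r : NNReal), g.edist hg p x ≤ r →
        f x ≤ (1 / 4 : ℝ) * ((r : ℝ) + Real.sqrt (2 * n)) ^ 2) ∧
      (∀ r : NNReal, riemannianMeasure (g.toContMDiffRiemannianMetric hg)
        {x : M | g.edist hg p x < r} ≤ ENNReal.ofReal (C₂ * (r : ℝ) ^ n))

end Literature.Geometry.Riemannian

end
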